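import Summits.BirchSwinnertonDyer.BirchSwinnertonDyer.Theorems.MordellShaFreeCutThreeAdicBDPTriple
import Summits.BirchSwinnertonDyer.BirchSwinnertonDyer.Theorems.MordellShaFreeCutResidualCensus
import Summits.BirchSwinnertonDyer.BirchSwinnertonDyer.Theorems.MordellShaFreeCutAssembly
import Summits.BirchSwinnertonDyer.Rank1Residual.Partition.AnticyclotomicControlJSWEmbAt

set_option autoImplicit false

/-! # Route `MordellShaFreeCut` (rung S2b) — the WHOLE ROUTE in the v5 currency of record: crux A
(`RankPosOfThreeSelmerCorankOne`, stmt-19159, residual) ⟺ (res) at `3`, and the leaf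
`rankOne_threeConverse_mordellCurve` ⟸ {(res) at `3`, (LB-exist), (LB-wan), (LB-bdp)} + Poitou–Tate +
six refereed facts

Cell `bsd-cn100`, prover seat `bsd-cn100-s2b-c3` g3. Supports, does not close, stmt-BirchSwinnertonDyer-19159
(`--supports … --as helper`). HONEST FRAMING: CONDITIONAL reductions only; nothing here proves crux A, crux B,
the leaf, Sylvester's conjecture or any case of BSD. No research statement is restated: (res) at `3` enters
as the hypothesis `hres` spelled EXACTLY as the registered `stub_threeLocNonDegeneracy` (line
`heegner-field-links` v5); the three BDP statements by their landed names
`MordellShaFreeCutThreeAdicBDPTriple.{ThreeAdicBDPElementExists, ThreeAdicWanDivisibility, ThreeAdicBDPValueAtOne}`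
(line `three-adic-bdp-triple` v5, p439508).

WHY THIS FILE. After 2026-08-26 the residual's census (`MordellShaFreeCutResidualCensus`, p436708/p438011)
reads «crux A ⟺ (res) modulo LINK B `ThreeAdicCharValueEqHeegnerLogSq` + PT + facts», while crux B's line of
record was RE-CUT (v5) from Link B into the BDP triple. The `p`-converse direction needs only the triple
(Link A ⟹ `F(0) ≠ 0` ⟹ (LB-wan) `𝓛(𝟙) ≠ 0` ⟹ (LB-bdp) `log_ω P ≠ 0`), NOT Link B's converse half; so
the residual's census is restated here in the currency of record, with the plumbing run in CORANK currency
(no Kato, no rank-one input — the corank-one Selmer group and (res) feed Link A through the landed algebra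
`stub_selmerAcBaseFinite_of_resCorankOne` + tower control, `MordellShaFreeCutResidualCensus.threeAdicControlOfCorankOne_of_res`):

* `heegnerPoint_not_isOfFinAddOrder_of_corankLinkA_of_bdpTriple` — corank-currency plumbing: Link A in
  CORANK form (`ThreeAdicControlOfCorankOne`) + the BDP triple ⟹ every Heegner point of level `N(W)` on a
  globally minimal `j = 0` curve over a Heegner field with `3` split and `corank_{ℤ₃} Sel_{3^∞}(W/K) = 1`
  has infinite order (same algebra as the landed rank-currency plumbing p439508: b2b's
  `X11b.Halves.two_mul_sub_one_le_valuation` with `a = 0`, THE embedding `embAt`, conjugate reading);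
* `cruxA_of_res_of_bdpTriple_of_poitouTate`, **`cruxA_iff_res_of_bdpTriple_of_poitouTate`** — crux A
  ⟸/⟺ (res) at `3` modulo the BDP triple + Poitou–Tate + {`3`-parity, modularity, Hoffstein–Luo, Kato,
  Gross 1984} (descent field `exists_heegnerField_descent_of_selmerCorank_eq_one`, minimal-model reduction
  as in `MordellShaFreeCutThreeAdicLinksCorank.cruxA_of_threeAdicLinks`; `⟹` = p435058's fact-free
  `threeLocNonDegeneracy_of_cruxA`);
* **`leaf_of_res_of_bdpTriple_of_poitouTate`** — THE ROUTE'S KERNEL CENSUS: leaf ⟸ {(res) at `3`,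
  (LB-exist), (LB-wan), (LB-bdp)} + Poitou–Tate + six refereed facts (Assembly `assembly_holds` of crux A
  above and crux B `cruxB_of_bdpTriple_of_poitouTate`, p439803).

[cite: Skinner2020, Thm. B and §2.2–2.3 (shape of (res))] [cite: CastellaGrossiLeeSkinner2022, §5.2 (proof of Thm. 5.2.1), Thm. 5.1.3]
[cite: Castella2018, proof of Thm. 2.3 with Thm. 3.4 (arXiv:1704.06608 pp. 5, 10) (shape)]
[cite: MilneADT2006, Ch. I, Thm. 4.10(b)] [cite: GrossZagier1986, Thm. I.6.3 with V.§2] -/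

noncomputable section

open scoped Classical

namespace Summit.BirchSwinnertonDyer.BirchSwinnertonDyer.Theorems.MordellShaFreeCutBDPTripleCensus

open PowerSeries WeierstrassCurve NumberField IsDedekindDomain Field Literature.NumberTheory.EllipticCurves
  Literature.NumberTheory.EllipticCurves.ModularForms Literature.NumberTheory.QuadraticFields
  Literature.NumberTheory.EllipticCurves.Castella2018
open Literature.NumberTheory.GaloisRepresentations Literature.NumberTheory.GaloisCohomology
open Summit.BirchSwinnertonDyer.BirchSwinnertonDyer.Theses.MordellShaFreeCut
open Summit.BirchSwinnertonDyer.BirchSwinnertonDyer.Theorems.MordellShaFreeCutThreeAdicBDPTriple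
  (ThreeAdicBDPElementExists ThreeAdicWanDivisibility ThreeAdicBDPValueAtOne cruxB_of_bdpTriple_of_poitouTate)
open Summit.BirchSwinnertonDyer.BirchSwinnertonDyer.Theorems.MordellShaFreeCutThreeAdicLinksCorank
  (ThreeAdicControlOfCorankOne)
open Summit.BirchSwinnertonDyer.BirchSwinnertonDyer.Theorems.MordellShaFreeCutResidualCensus
  (threeAdicControlOfCorankOne_of_res)
open Summit.BirchSwinnertonDyer.BirchSwinnertonDyer.Theorems.MordellShaFreeCutLocNonDegeneracy
  (threeLocNonDegeneracy_of_cruxA)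

/-! ## 1. Corank-currency plumbing -/

/-- **Link A in CORANK form + the BDP triple force every Heegner point to be non-torsion at a corank-one
datum** (no Kato, no rank hypothesis). For `W/ℚ` globally minimal elliptic with `j = 0`, `K` imaginary
quadratic with the Heegner hypothesis for `N = N(W)` and for `3`, `corank_{ℤ₃} Sel_{3^∞}(W/K) = 1`, and a
Heegner point `P` of level `N`: `F(0) ≠ 0` (`hAc` at THE embedding `embAt K 3 v` of a degree-one `v ∣ 3`)
⟹ `𝓛(𝟙) ≠ 0` ((LB-exist) for `𝓛`, (LB-wan) along `X11b.Halves.toUnr 3`) ⟹ `log_ω(τ_* P) ≠ 0` ((LB-bdp) at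
the Galois-conjugate reading, b2b's `X11b.Halves.two_mul_sub_one_le_valuation` with `a = 0`) ⟹ `P` not
torsion (`AcPConverseLinks.padicLogPoint_formalIndex_smul_eq_zero_of_isOfFinAddOrder`). CONDITIONAL;
credits nothing. [cite: Castella2018, proof of Thm. 2.3 with Thm. 3.4 (arXiv:1704.06608 pp. 5, 10) (shape)]
[cite: CastellaGrossiLeeSkinner2022, §5.2 (proof of Thm. 5.2.1)] [cite: SilvermanAEC2009, IV.6.4 and VII.2.2] -/
theorem heegnerPoint_not_isOfFinAddOrder_of_corankLinkA_of_bdpTriple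
    (hAc : ThreeAdicControlOfCorankOne) (hE : ThreeAdicBDPElementExists)
    (hWan : ThreeAdicWanDivisibility) (hV : ThreeAdicBDPValueAtOne) :
    ∀ (W : WeierstrassCurve ℚ) [W.IsElliptic] [W.IsGloballyMinimal], W.j = 0 →
      ∀ (K : Type) [Field K] [NumberField K] (N : ℕ) [NeZero N], W.conductorNorm ℤ = N →
        IsImaginaryQuadratic K → SatisfiesHeegnerHypothesis N K → SatisfiesHeegnerHypothesis 3 K →
          (W.baseChange K).selmerCorank 3 = 1 →
            ∀ (P : (W.baseChange K).toAffine.Point), IsHeegnerPoint N W K P → ¬ IsOfFinAddOrder P := by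
  intro W _ _ hj K _ _ N _ hN hK hHN hH3 hcK P hP hPtor
  haveI : Fact (Nat.Prime 3) := ⟨Nat.prime_three⟩
  have hsplit : ((Ideal.span {(3 : ℤ)}).primesOver (𝓞 K)).ncard = 2 :=
    hH3 3 Nat.prime_three (dvd_refl 3)
  -- (1) the anticyclotomic datum, THE embedding at a degree-one `v ∣ 3`, the partner `v̄`
  obtain ⟨κ, γ, v, hκ, hγ, hv3, he, hf⟩ :=
    Summit.BirchSwinnertonDyer.Rank1Residual.X11b.exists_anticyclotomic_generator_degreeOnePrime 3 K hK hH3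
  haveI : Fact (κ.IsTopGenerator γ) := ⟨hγ⟩
  set ι : K →+* ℚ_[3] := Summit.BirchSwinnertonDyer.Rank1Residual.X11b.embAt K 3 v hv3 he hf with hιdef
  have hv : ∀ x : 𝓞 K, x ∈ v.asIdeal ↔ ‖ι (x : K)‖ < 1 :=
    Summit.BirchSwinnertonDyer.Rank1Residual.X11b.mem_asIdeal_iff_norm_embAt_lt_one v hv3 he hf
  obtain ⟨vbar, hvbar, hne⟩ :=
    Summit.BirchSwinnertonDyer.Rank1Residual.X11b.exists_other_prime hH3 v hv3
  -- (2) Link A (corank form): a generator `F` of `char_Λ 𝔛` with `F(0) ≠ 0`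
  obtain ⟨m, hm⟩ := hAc W hj K N hN hK hHN hH3 ι v vbar hv hvbar hne κ hκ γ hcK
  obtain ⟨-, F, hF, hF0, -⟩ := hm
  have hFmem : F ∈ AcSelmer.XAc.charIdeal (W.baseChange K) 3 κ vbar ∅ γ := by
    rw [hF]; exact Ideal.mem_span_singleton_self F
  -- (3) the Heegner point data; its Galois conjugate readable at an infinite place
  obtain ⟨Dt, H, ιK, hPK⟩ := hP
  obtain ⟨w₀⟩ := (inferInstance : Nonempty (InfinitePlace K))
  haveI : IsGalois ℚ K := by
    haveI : Algebra.IsQuadraticExtension ℚ K := ⟨hK.1⟩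
    infer_instance
  obtain ⟨σ, hσ⟩ := NumberField.ComplexEmbedding.exists_comp_symm_eq_of_comp_eq (k := ℚ)
    w₀.embedding ιK (by ext x; simp)
  set τ : K →+* K := ((σ.symm : K ≃ₐ[ℚ] K) : K →+* K) with hτdef
  set P' := WeierstrassCurve.Affine.Point.map τ.toRatAlgHom P with hP'def
  have hP' : WeierstrassCurve.Affine.Point.map w₀.embedding.toRatAlgHom P' =
      heegnerPointComplex Dt H := by
    rw [hP'def, WeierstrassCurve.Affine.Point.map_map]
    have hcomp : w₀.embedding.toRatAlgHom.comp τ.toRatAlgHom = ιK.toRatAlgHom := by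
      apply AlgHom.ext
      intro x
      have := RingHom.congr_fun hσ x
      simpa [hτdef] using this
    rw [hcomp]
    exact hPK
  have hP'tor : IsOfFinAddOrder P' := by
    rw [hP'def]; exact AddMonoidHom.isOfFinAddOrder _ hPtor
  -- (4) the BDP element and its embedding datum
  obtain ⟨ι', hι', ΩK, Ωp, L, hΩK, hBDP⟩ := hE W hj K N Dt v κ γ hN hK hHN hsplit hv3 hκ
  -- (5) (LB-wan) along `toUnr : ℤ₃ → R₀`
  obtain ⟨k, hk⟩ := hWan W hj ι' K N Dt v vbar κ γ hN hK hHN hsplit hι' hvbar hne hκ ΩK Ωp L hΩK hBDP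
    (Summit.BirchSwinnertonDyer.Rank1Residual.X11b.Halves.toUnr 3)
    (Summit.BirchSwinnertonDyer.Rank1Residual.X11b.Halves.coe_toUnr 3)
  set F' : IwasawaAlgebra 3 := C ((3 : ℤ_[3]) ^ k) * F with hF'def
  have hF'0 : constantCoeff F' ≠ 0 := by
    rw [hF'def, map_mul, PowerSeries.constantCoeff_C]
    exact mul_ne_zero (pow_ne_zero _ (by norm_num)) hF0
  have hfL : PowerSeries.map (Summit.BirchSwinnertonDyer.Rank1Residual.X11b.Halves.toUnr 3) F' ∈
      Ideal.span {L} := by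
    have hmap : PowerSeries.map (Summit.BirchSwinnertonDyer.Rank1Residual.X11b.Halves.toUnr 3) F' =
        C ((3 : unrIntegers 3) ^ k) *
          PowerSeries.map (Summit.BirchSwinnertonDyer.Rank1Residual.X11b.Halves.toUnr 3) F := by
      rw [hF'def, map_mul, PowerSeries.map_C, map_pow, map_ofNat]
    rw [hmap]
    exact hk F hFmem
  -- (6) (LB-bdp) at the conjugate reading `P'`
  obtain ⟨u, hu⟩ := hV W hj ι' K N Dt H w₀ ι v κ γ P' hN hK hHN hsplit hv3 hι' hκ hP' hv ΩK Ωp L hΩK hBDP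
  set x : ℚ_[3] := (Dt.c : ℚ_[3])⁻¹ *
      (1 - (W.LFunction 3 : ℚ_[3]) * (3 : ℚ_[3])⁻¹ + (if (3 : ℕ) ∣ N then 0 else (3 : ℚ_[3])⁻¹)) *
      padicLogOmega W 3 ι P' with hxdef
  have hshape : ((Dt.c : ℚ_[3])⁻¹) ^ 2 *
      (1 - (W.LFunction 3 : ℚ_[3]) * (3 : ℚ_[3])⁻¹ + (if (3 : ℕ) ∣ N then 0 else (3 : ℚ_[3])⁻¹)) ^ 2 *
      (padicLogOmega W 3 ι P') ^ 2 =
      (((1 : ℚ_[3]) - ((0 : ℤ) : ℚ_[3]) * ((3 : ℕ) : ℚ_[3])⁻¹) * x) ^ 2 := by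
    rw [hxdef]; push_cast; ring
  rw [hshape, map_pow] at hu
  -- (7) the algebra of halves: `x ≠ 0`, hence `log_ω P' ≠ 0`; a torsion point has zero logarithm
  obtain ⟨hx0, -⟩ :=
    Summit.BirchSwinnertonDyer.Rank1Residual.X11b.Halves.two_mul_sub_one_le_valuation 3 hF'0 hfL u 0 hu
  apply hx0
  rw [hxdef]
  unfold padicLogOmega
  rw [AcPConverseLinks.padicLogPoint_formalIndex_smul_eq_zero_of_isOfFinAddOrder W 3 ι hP'tor, zero_div,
    mul_zero]

/-! ## 2. Crux A from (res) and the BDP triple -/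

/-- **Globally minimal `j = 0` case of crux A from Link A in corank form and the BDP triple** (five
refereed facts: `3`-parity, modularity, Hoffstein–Luo, Kato — for the descent field — and Gross 1984):
descend to the Heegner field `K` (`exists_heegnerField_descent_of_selmerCorank_eq_one`: corank one over
`K`, `rank W(K) = rank W(ℚ)`), take a Heegner point, apply the corank-currency plumbing, Mordell–Weil.
[cite: CastellaGrossiLeeSkinner2022, §5.2 (proof of Thm. 5.2.1)] -/
theorem rankPos_minimal_of_corankLinkA_of_bdpTriple
    (hpar : ∀ (W : WeierstrassCurve ℚ) [W.IsElliptic] (p : ℕ) [Fact p.Prime], p_parity W p)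
    (hmod : ModularForms.exists_isNewformOf) (hHL : HoffsteinLuo1997_exists_twist_L_one_ne_zero)
    (hKato : ∀ (W : WeierstrassCurve ℚ) [W.IsElliptic] (p : ℕ) [Fact p.Prime],
      kato_finite_of_L_one_ne_zero W p)
    (hHP : ∀ (W : WeierstrassCurve ℚ) (K : Type) [Field K] [NumberField K],
      exists_isHeegnerPoint W K)
    (hAc : ThreeAdicControlOfCorankOne) (hE : ThreeAdicBDPElementExists)
    (hWan : ThreeAdicWanDivisibility) (hV : ThreeAdicBDPValueAtOne) :
    ∀ (W : WeierstrassCurve ℚ) [W.IsElliptic] [W.IsGloballyMinimal], W.j = 0 →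
      W.selmerCorank 3 = 1 → 1 ≤ W.mordellWeilRank := by
  intro W _ _ hj hc
  haveI : Fact (Nat.Prime 3) := ⟨Nat.prime_three⟩
  haveI : NeZero (W.conductorNorm ℤ) := ⟨(W.conductorNorm_pos_holds).ne'⟩
  obtain ⟨K, _, _, hK, -, hHN, hH3, -, -, hcK, hrk, -⟩ :=
    exists_heegnerField_descent_of_selmerCorank_eq_one hpar hmod hHL hKato W 3 hc 0
  obtain ⟨P, hP⟩ := hHP W K hK hHN
  have hPnt : ¬ IsOfFinAddOrder P :=
    heegnerPoint_not_isOfFinAddOrder_of_corankLinkA_of_bdpTriple hAc hE hWan hV W hj K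
      (W.conductorNorm ℤ) rfl hK hHN hH3 hcK P hP
  have hrkK : 1 ≤ (W.baseChange K).mordellWeilRank :=
    one_le_mordellWeilRank_of_not_isOfFinAddOrder _ (W.baseChange K).module_finite_point_holds hPnt
  rwa [hrk] at hrkK

/-- **Crux A `RankPosOfThreeSelmerCorankOne` from (res) at `3`, the BDP triple, Poitou–Tate and five
refereed facts**: Link A in corank form is `threeAdicControlOfCorankOne_of_res hPT hres` (p438011: (res) +
the landed algebra `stub_selmerAcBaseFinite_of_resCorankOne` + tower control), then
`rankPos_minimal_of_corankLinkA_of_bdpTriple` and the minimal-model reduction (globally minimal model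
`C • E_D`, `j = 0`, Selmer corank and rank invariant under the change of variables). CONDITIONAL;
credits nothing. [cite: SilvermanAEC2009, III.3.1(b) and VIII.8] [cite: Skinner2020, Thm. B (shape)] -/
theorem cruxA_of_res_of_bdpTriple_of_poitouTate
    (hpar : ∀ (W : WeierstrassCurve ℚ) [W.IsElliptic] (p : ℕ) [Fact p.Prime], p_parity W p)
    (hmod : ModularForms.exists_isNewformOf) (hHL : HoffsteinLuo1997_exists_twist_L_one_ne_zero)
    (hKato : ∀ (W : WeierstrassCurve ℚ) [W.IsElliptic] (p : ℕ) [Fact p.Prime],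
      kato_finite_of_L_one_ne_zero W p)
    (hHP : ∀ (W : WeierstrassCurve ℚ) (K : Type) [Field K] [NumberField K],
      exists_isHeegnerPoint W K)
    (hPT : ∀ (K : Type) [Field K] [NumberField K], poitouTate_sum_localTatePairing_eq_zero K)
    (hres : ∀ (W : WeierstrassCurve ℚ) [W.IsElliptic] [W.IsGloballyMinimal], W.j = 0 →
      ∀ (K : Type) [Field K] [NumberField K],
      IsImaginaryQuadratic K → SatisfiesHeegnerHypothesis 3 K →
        (W.baseChange K).selmerCorank 3 = 1 →
      ∀ (w : HeightOneSpectrum (𝓞 K)), ((3 : ℕ) : 𝓞 K) ∈ w.asIdeal →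
        Finite ↥((W.baseChange K).selmerGroupPInfty 3 ⊓
          selmerLocalKerPrimaryTorsion (W.baseChange K) (w.adicCompletion K) 3))
    (hE : ThreeAdicBDPElementExists) (hWan : ThreeAdicWanDivisibility) (hV : ThreeAdicBDPValueAtOne) :
    RankPosOfThreeSelmerCorankOne := by
  intro D hD hc
  haveI := isElliptic_mordellCurve hD
  haveI : Fact (Nat.Prime 3) := ⟨Nat.prime_three⟩
  obtain ⟨C, hmin⟩ := hasGlobalMinimalModel_rat_holds (mordellCurve D)
  haveI : (C • mordellCurve D).IsGloballyMinimal := hmin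
  have hj : (C • mordellCurve D).j = 0 := by
    rw [variableChange_j]; exact (mordellCurve D).j_eq_zero (mordellCurve_c₄ _)
  have hc' : (C • mordellCurve D).selmerCorank 3 = 1 := by
    rw [← selmerCorank_eq_of_variableChange 3 (rfl : C • mordellCurve D = C • mordellCurve D)]
    exact hc
  have h1 := rankPos_minimal_of_corankLinkA_of_bdpTriple hpar hmod hHL hKato hHP
    (threeAdicControlOfCorankOne_of_res hPT hres) hE hWan hV (C • mordellCurve D) hj hc'
  rwa [mordellWeilRank_variableChange_holds] at h1

/-- **KERNEL CENSUS of the residual in the currency of record: modulo the BDP triple, Poitou–Tate and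
five refereed facts, crux A `RankPosOfThreeSelmerCorankOne` ⟺ (res) at `3`** (the registered
`stub_threeLocNonDegeneracy` statement): `⟸` is `cruxA_of_res_of_bdpTriple_of_poitouTate`, `⟹` the
fact-free `MordellShaFreeCutLocNonDegeneracy.threeLocNonDegeneracy_of_cruxA` (p435058). CONDITIONAL;
credits nothing. [cite: Skinner2020, Thm. B and §2.2 (shape of (res))]
[cite: WZhang2014, Thm. 1.3 and Remark 2 (p. 198)] -/
theorem cruxA_iff_res_of_bdpTriple_of_poitouTate
    (hpar : ∀ (W : WeierstrassCurve ℚ) [W.IsElliptic] (p : ℕ) [Fact p.Prime], p_parity W p)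
    (hmod : ModularForms.exists_isNewformOf) (hHL : HoffsteinLuo1997_exists_twist_L_one_ne_zero)
    (hKato : ∀ (W : WeierstrassCurve ℚ) [W.IsElliptic] (p : ℕ) [Fact p.Prime],
      kato_finite_of_L_one_ne_zero W p)
    (hHP : ∀ (W : WeierstrassCurve ℚ) (K : Type) [Field K] [NumberField K],
      exists_isHeegnerPoint W K)
    (hPT : ∀ (K : Type) [Field K] [NumberField K], poitouTate_sum_localTatePairing_eq_zero K)
    (hE : ThreeAdicBDPElementExists) (hWan : ThreeAdicWanDivisibility) (hV : ThreeAdicBDPValueAtOne) :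
    RankPosOfThreeSelmerCorankOne ↔
      ∀ (W : WeierstrassCurve ℚ) [W.IsElliptic] [W.IsGloballyMinimal], W.j = 0 →
        ∀ (K : Type) [Field K] [NumberField K],
        IsImaginaryQuadratic K → SatisfiesHeegnerHypothesis 3 K →
          (W.baseChange K).selmerCorank 3 = 1 →
        ∀ (w : HeightOneSpectrum (𝓞 K)), ((3 : ℕ) : 𝓞 K) ∈ w.asIdeal →
          Finite ↥((W.baseChange K).selmerGroupPInfty 3 ⊓
            selmerLocalKerPrimaryTorsion (W.baseChange K) (w.adicCompletion K) 3) :=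
  ⟨fun hA W _ _ hj K _ _ hK hH3 hcK w hw ↦ threeLocNonDegeneracy_of_cruxA hA W hj K hK hH3 hcK w hw,
    fun hres ↦ cruxA_of_res_of_bdpTriple_of_poitouTate hpar hmod hHL hKato hHP hPT hres hE hWan hV⟩

/-! ## 3. The whole route -/

/-- **THE ROUTE'S KERNEL CENSUS (v5 currency of record): the rung-S2b leaf
`rankOne_threeConverse_mordellCurve` ⟸ {(res) at `3`, (LB-exist), (LB-wan), (LB-bdp)} + Poitou–Tate + the
six refereed facts** (`3`-parity, modularity, Hoffstein–Luo, Kato, Gross 1984, Gross–Zagier + Kolyvagin):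
the route's Assembly (`MordellShaFreeCutAssembly.assembly_holds`) of crux A
(`cruxA_of_res_of_bdpTriple_of_poitouTate`) and crux B (`MordellShaFreeCutThreeAdicBDPTriple.cruxB_of_bdpTriple_of_poitouTate`,
p439803). Research content of the route = ONE Selmer-only statement at the additive prime `3` + ONE
construction + ONE main-conjecture divisibility + ONE special-value formula; textbook debt = Poitou–Tate.
CONDITIONAL; neither BSD nor Sylvester's conjecture is touched. [cite: GrossZagier1986, Thm. I.6.3 with V.§2]
[cite: CastellaGrossiLeeSkinner2022, §5.2 (proof of Thm. 5.2.1)] [cite: MilneADT2006, Ch. I, Thm. 4.10(b)] -/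
theorem leaf_of_res_of_bdpTriple_of_poitouTate
    (hpar : ∀ (W : WeierstrassCurve ℚ) [W.IsElliptic] (p : ℕ) [Fact p.Prime], p_parity W p)
    (hmod : ModularForms.exists_isNewformOf) (hHL : HoffsteinLuo1997_exists_twist_L_one_ne_zero)
    (hKato : ∀ (W : WeierstrassCurve ℚ) [W.IsElliptic] (p : ℕ) [Fact p.Prime],
      kato_finite_of_L_one_ne_zero W p)
    (hHP : ∀ (W : WeierstrassCurve ℚ) (K : Type) [Field K] [NumberField K],
      exists_isHeegnerPoint W K)
    (hGZ : ∀ (W : WeierstrassCurve ℚ) (N : ℕ) [NeZero N] (K : Type) [Field K] [NumberField K],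
      analyticRankEK_eq_one_iff_heegner_nonTorsion W N K)
    (hPT : ∀ (K : Type) [Field K] [NumberField K], poitouTate_sum_localTatePairing_eq_zero K)
    (hres : ∀ (W : WeierstrassCurve ℚ) [W.IsElliptic] [W.IsGloballyMinimal], W.j = 0 →
      ∀ (K : Type) [Field K] [NumberField K],
      IsImaginaryQuadratic K → SatisfiesHeegnerHypothesis 3 K →
        (W.baseChange K).selmerCorank 3 = 1 →
      ∀ (w : HeightOneSpectrum (𝓞 K)), ((3 : ℕ) : 𝓞 K) ∈ w.asIdeal →
        Finite ↥((W.baseChange K).selmerGroupPInfty 3 ⊓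
          selmerLocalKerPrimaryTorsion (W.baseChange K) (w.adicCompletion K) 3))
    (hE : ThreeAdicBDPElementExists) (hWan : ThreeAdicWanDivisibility) (hV : ThreeAdicBDPValueAtOne) :
    rankOne_threeConverse_mordellCurve :=
  MordellShaFreeCutAssembly.assembly_holds
    (cruxA_of_res_of_bdpTriple_of_poitouTate hpar hmod hHL hKato hHP hPT hres hE hWan hV)
    (cruxB_of_bdpTriple_of_poitouTate hpar hmod hHL hKato hHP hGZ hPT hE hWan hV)

end Summit.BirchSwinnertonDyer.BirchSwinnertonDyer.Theorems.MordellShaFreeCutBDPTripleCensus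

end
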